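import Mathlib
import Literature.Analysis.FluidPDE.GaussianVortexPlanar
import Literature.Analysis.FluidPDE.GaussianVortexPlanarProofs
import Literature.Analysis.FluidPDE.BiotSavart2DSymmetry
import Summits.AnomalousDissipation.AnomalousDissipation.Theorems.MarginalStabilityChainStretchedVortexRowsStubCellSolvabilityTools
import Summits.AnomalousDissipation.AnomalousDissipation.Theorems.MarginalStabilityChainStretchedVortexRowsStubHardyWirtingerEven
import Summits.AnomalousDissipation.AnomalousDissipation.Theorems.MarginalStabilityChainStretchedVortexRowsStubCoreRotationLocalSkew
import Summits.AnomalousDissipation.AnomalousDissipation.Theorems.MarginalStabilityChainStretchedVortexRowsStubCircAvgTools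
import Summits.AnomalousDissipation.AnomalousDissipation.Theorems.MarginalStabilityChainStretchedVortexRowsStubCircAvgPolar
import HarnessLib

/-!
# Helper `circAvg_wirtinger_even` toward stub `stub_coreInverse` of the line `braid-closed-large-circulation-gluing`
# (crux stmt-AnomalousDissipation-3009, `MarginalStabilityChain.StretchedVortexRows`)

**Wirtinger's inequality on circles for EVEN functions, in the rotation-weighted Gaussian norm** (ingredient (I10) of
the energy method for `stub_coreInverse`): for `u ∈ C¹(ℝ²)` even with `u`, `Du` bounded,
`∫ G Ω (u − u₀)² ≤ ¼ ∫ G Ω (Du[ξ^⊥])²`, where `u₀(ξ) = (2π)⁻¹∫₀^{2π} u(cos t · ξ + sin t · ξ^⊥) dt` is the circular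
mean (radial part) of `u`, `G = gaussVortexProfile` and `Ω(ξ) = (8π)⁻¹ φ(|ξ|²/4)` is the angular velocity of the
Gaussian vortex. The non-radial part `u − u₀` is thus controlled by the angular derivative, with the SHARP constant
`¼` because an even function is `π`-periodic on every circle. Proof:

* `intervalIntegral_sub_const_sq_circle_le`: on the circle `γ_r(θ) = (r cos θ, r sin θ)`, `h = u ∘ γ_r − c` is `C¹`,
  `π`-periodic (evenness: `γ_r(θ + π) = −γ_r(θ)`), and if `∫_{−π}^{π} h = 0` then `h` has zero mean on both half
  periods `[−π, 0]`, `[0, π]`, so the sharp periodic Wirtinger inequality (landed `wirtinger_periodic`) with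
  `b − a = π` gives `∫_{−π}^{π} h² ≤ (π/2π)² ∫_{−π}^{π} h'² = ¼ ∫ h'²`, and `h'(θ) = Du(γ_r θ)[γ_r(θ)^⊥]`
  (`γ_r' = γ_r^⊥`, landed `hasDerivAt_comp_toLp_cos_sin`);
* assembly (`circAvg_wirtinger_even`): on each circle `G`, `Ω` are constant and `u₀ ∘ γ_r ≡ c_r`, the mean of
  `u ∘ γ_r` (toolkit `circularMean_circlePoint`), and `u ∘ γ_r − c_r` has zero mean (toolkit
  `intervalIntegral_sub_circularMean_eq_zero'`); the circle-wise inequalities, multiplied by `r G(r) Ω(r) ≥ 0`,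
  integrate to the claim by the comparison principle `integral_le_integral_of_forall_circle` (polar coordinates for
  lower integrals), the right-hand side `¼ G Ω (Du[ξ^⊥])² ≤ (M²/32π)(1 + |ξ|)² G` being integrable.

The circular-mean toolkit itself (radiality, evenness, `Cⁿ` regularity and bounds of `u₀`, `Du₀[ξ^⊥] = 0`, zero
circular means of `u − u₀`, `L²` contraction `∫ρu₀² ≤ ∫ρu²` for radial weights) is in the two imported modules
`…StubCircAvgTools` and `…StubCircAvgPolar`.

References: G. H. Hardy, J. E. Littlewood, G. Pólya, *Inequalities*, Thm. 258 (Wirtinger); Th. Gallay, C. E. Wayne,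
Comm. Math. Phys. 255 (2005) §4.1; Th. Gallay, Y. Maekawa, arXiv:1610.08384 §4.1.
-/

set_option linter.dupNamespace false

noncomputable section

open scoped RealInnerProductSpace Topology
open MeasureTheory WithLp Function Set Real intervalIntegral Filter

namespace Summit.AnomalousDissipation.AnomalousDissipation.Theorems.MarginalStabilityChainStretchedVortexRows

open Literature.Analysis.FluidPDE

/-! ### Wirtinger on circles for even functions (sharp constant `1/4`) -/

/-- **Circle-wise Wirtinger inequality for even functions, with the angular derivative.** For `u ∈ C¹(ℝ²)` even,
`r, c ∈ ℝ` with `∫_{−π}^{π} (u(γ_r θ) − c) dθ = 0` (`γ_r(θ) = (r cos θ, r sin θ)`):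
`∫_{−π}^{π} (u(γ_r θ) − c)² dθ ≤ ¼ ∫_{−π}^{π} (Du(γ_r θ)[γ_r(θ)^⊥])² dθ` — `θ ↦ u(γ_r θ) − c` is `π`-periodic by evenness
with zero mean on each half period, so the sharp Wirtinger inequality (`wirtinger_periodic`) applies with period `π`,
and its derivative is the angular derivative `Du[ξ^⊥]` along the circle (`γ_r' = γ_r^⊥`). [folklore] -/
theorem intervalIntegral_sub_const_sq_circle_le (u : EuclideanSpace ℝ (Fin 2) → ℝ) (hu : ContDiff ℝ 1 u)
    (heven : ∀ ξ, u (-ξ) = u ξ) (r c : ℝ)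
    (hmean : ∫ θ in (-π)..π, (u (toLp 2 ![r * Real.cos θ, r * Real.sin θ]) - c) = 0) :
    ∫ θ in (-π)..π, (u (toLp 2 ![r * Real.cos θ, r * Real.sin θ]) - c) ^ 2 ≤
      1 / 4 * ∫ θ in (-π)..π, (fderiv ℝ u (toLp 2 ![r * Real.cos θ, r * Real.sin θ])
        (perp (toLp 2 ![r * Real.cos θ, r * Real.sin θ]))) ^ 2 := by
  set γ : ℝ → EuclideanSpace ℝ (Fin 2) := fun θ => toLp 2 ![r * Real.cos θ, r * Real.sin θ] with hγ
  set g : ℝ → ℝ := fun θ => u (γ θ) - c with hg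
  have hγC : ContDiff ℝ 1 γ := by
    have e : γ = fun θ => (r * Real.cos θ) • EuclideanSpace.single 0 (1:ℝ) +
        (r * Real.sin θ) • EuclideanSpace.single 1 (1:ℝ) := funext fun θ => toLp_cos_sin_eq r θ
    rw [e]
    fun_prop
  have hgC : ContDiff ℝ 1 g := (hu.comp hγC).sub contDiff_const
  have hd : Differentiable ℝ u := hu.differentiable (by simp)
  have hgd : ∀ θ, HasDerivAt g (fderiv ℝ u (γ θ) (perp (γ θ))) θ := fun θ =>
    (hasDerivAt_comp_toLp_cos_sin (hd _)).sub_const c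
  have hderiv : ∀ θ, fderiv ℝ u (γ θ) (perp (γ θ)) = deriv g θ := fun θ => (hgd θ).deriv.symm
  have hγπ : ∀ θ, γ (θ + π) = -γ θ := fun θ => by
    ext i
    fin_cases i <;> simp [hγ, Real.cos_add_pi, Real.sin_add_pi]
  have hper : Periodic g π := fun θ => by
    show u (γ (θ + π)) - c = u (γ θ) - c
    rw [hγπ, heven]
  have hgc : Continuous g := hgC.continuous
  have hdc : Continuous (deriv g) := hgC.continuous_deriv (by simp)
  have hii : ∀ s t, IntervalIntegrable g volume s t := fun s t => hgc.intervalIntegrable _ _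
  -- zero means on the half periods `[-π, 0]` and `[0, π]`
  have hsplit : ∫ θ in (-π)..π, g θ = (∫ θ in (-π)..0, g θ) + ∫ θ in (0:ℝ)..π, g θ :=
    (integral_add_adjacent_intervals (hii _ _) (hii _ _)).symm
  have hshift : ∫ θ in (-π)..0, g θ = ∫ θ in (0:ℝ)..π, g θ := by
    have h := hper.intervalIntegral_add_eq (-π) 0
    rwa [neg_add_cancel, zero_add] at h
  have hmean' : ∫ θ in (-π)..π, g θ = 0 := hmean
  have hmean0 : ∫ θ in (0:ℝ)..π, g θ = 0 := by linarith
  have hmean1 : ∫ θ in (-π)..0, g θ = 0 := by linarith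
  -- the sharp Wirtinger inequality on both half periods
  have hW0 := wirtinger_periodic hgC pi_pos (by simpa using (hper 0).symm) hmean0
  have hW1 := wirtinger_periodic hgC (neg_lt_zero.2 pi_pos) (by simpa using (hper (-π)).symm) hmean1
  have e0 : ((π - 0) / (2 * π)) ^ 2 = 1 / 4 := by field_simp; norm_num
  have e1 : ((0 - -π) / (2 * π)) ^ 2 = 1 / 4 := by field_simp; norm_num
  rw [e0] at hW0
  rw [e1] at hW1
  have hii2 : ∀ s t, IntervalIntegrable (fun θ => g θ ^ 2) volume s t := fun s t =>
    (hgc.pow 2).intervalIntegrable _ _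
  have hii3 : ∀ s t, IntervalIntegrable (fun θ => deriv g θ ^ 2) volume s t := fun s t =>
    (hdc.pow 2).intervalIntegrable _ _
  have hsum2 : ∫ θ in (-π)..π, g θ ^ 2 = (∫ θ in (-π)..0, g θ ^ 2) + ∫ θ in (0:ℝ)..π, g θ ^ 2 :=
    (integral_add_adjacent_intervals (hii2 _ _) (hii2 _ _)).symm
  have hsum3 : ∫ θ in (-π)..π, deriv g θ ^ 2 =
      (∫ θ in (-π)..0, deriv g θ ^ 2) + ∫ θ in (0:ℝ)..π, deriv g θ ^ 2 :=
    (integral_add_adjacent_intervals (hii3 _ _) (hii3 _ _)).symm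
  show ∫ θ in (-π)..π, g θ ^ 2 ≤ 1 / 4 * ∫ θ in (-π)..π, (fderiv ℝ u (γ θ) (perp (γ θ))) ^ 2
  simp_rw [hderiv]
  rw [hsum2, hsum3]
  linarith

/-! ### The main inequality -/

/-- W3-A (I10 + circular-mean toolkit): Wirtinger on circles for EVEN functions, in the rotation-weighted Gaussian norm:
`∫ G Ω (u − u₀)² ≤ ¼ ∫ G Ω (Du[ξ^⊥])²`, `u₀` = circular mean (average over rotations), `Ω = (8π)⁻¹φ(|ξ|²/4)`. -/
theorem circAvg_wirtinger_even :
    ∀ u : EuclideanSpace ℝ (Fin 2) → ℝ, ContDiff ℝ 1 u → (∀ ξ, u (-ξ) = u ξ) →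
      (∃ M : ℝ, ∀ ξ, |u ξ| ≤ M ∧ ‖fderiv ℝ u ξ‖ ≤ M) →
      ∫ ξ, gaussVortexProfile ξ * ((8 * Real.pi)⁻¹ * burgersPhi (‖ξ‖ ^ 2 / 4)) *
          (u ξ - (2 * Real.pi)⁻¹ * ∫ t in (0:ℝ)..(2 * Real.pi), u (Real.cos t • ξ + Real.sin t • perp ξ)) ^ 2 ≤
        1 / 4 * ∫ ξ, gaussVortexProfile ξ * ((8 * Real.pi)⁻¹ * burgersPhi (‖ξ‖ ^ 2 / 4)) *
          (fderiv ℝ u ξ (perp ξ)) ^ 2 := by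
  intro u hu heven hbd
  obtain ⟨M, hM⟩ := hbd
  set u₀ : EuclideanSpace ℝ (Fin 2) → ℝ := fun ξ => (2 * π)⁻¹ * ∫ t in (0:ℝ)..2 * π,
    u (Real.cos t • ξ + Real.sin t • perp ξ) with hu₀
  have hπ8 : (0:ℝ) < (8 * π)⁻¹ := by positivity
  -- continuity, signs and bounds of the ingredients
  have huc : Continuous u := hu.continuous
  have hu₀c : Continuous u₀ := continuous_circularMean hu₀ huc
  have hDc : Continuous fun ξ : EuclideanSpace ℝ (Fin 2) => fderiv ℝ u ξ (perp ξ) :=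
    (hu.continuous_fderiv (by simp)).clm_apply continuous_perp
  have hΩc : Continuous fun ξ : EuclideanSpace ℝ (Fin 2) => (8 * π)⁻¹ * burgersPhi (‖ξ‖ ^ 2 / 4) :=
    continuous_const.mul ((contDiff_burgersPhi (n := 0)).continuous.comp ((continuous_norm.pow 2).div_const 4))
  have hGc : Continuous gaussVortexProfile := (contDiff_gaussVortexProfile (n := 0)).continuous
  have hΩ0 : ∀ ξ : EuclideanSpace ℝ (Fin 2), 0 ≤ (8 * π)⁻¹ * burgersPhi (‖ξ‖ ^ 2 / 4) := fun ξ =>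
    mul_nonneg hπ8.le (burgersPhi_pos _).le
  have hΩ1 : ∀ ξ : EuclideanSpace ℝ (Fin 2), (8 * π)⁻¹ * burgersPhi (‖ξ‖ ^ 2 / 4) ≤ (8 * π)⁻¹ := fun ξ =>
    mul_le_of_le_one_right hπ8.le (burgersPhi_le_one (by positivity))
  have hG0 : ∀ ξ, 0 ≤ gaussVortexProfile ξ := fun ξ => (gaussVortexProfile_pos ξ).le
  -- integrability of the right-hand side: `¼ G Ω (Du[ξ^⊥])² ≤ (M²/(32π)) (1 + |ξ|)² G`
  have hF₂i : Integrable fun ξ : EuclideanSpace ℝ (Fin 2) => 1 / 4 * (gaussVortexProfile ξ *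
      ((8 * π)⁻¹ * burgersPhi (‖ξ‖ ^ 2 / 4)) * (fderiv ℝ u ξ (perp ξ)) ^ 2) := by
    refine integrable_of_le_one_add_norm_pow_mul_gauss (A := 1 / 4 * (8 * π)⁻¹ * M ^ 2) (N := 2)
      (continuous_const.mul ((hGc.mul hΩc).mul (hDc.pow 2))) fun ξ => ?_
    have h1 : |fderiv ℝ u ξ (perp ξ)| ≤ M * ‖ξ‖ := by
      calc |fderiv ℝ u ξ (perp ξ)| = ‖fderiv ℝ u ξ (perp ξ)‖ := (Real.norm_eq_abs _).symm
        _ ≤ ‖fderiv ℝ u ξ‖ * ‖perp ξ‖ := ContinuousLinearMap.le_opNorm _ _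
        _ ≤ M * ‖ξ‖ := by
            rw [norm_perp]
            exact mul_le_mul_of_nonneg_right (hM ξ).2 (norm_nonneg _)
    have h2 : (fderiv ℝ u ξ (perp ξ)) ^ 2 ≤ M ^ 2 * (1 + ‖ξ‖) ^ 2 := by
      calc (fderiv ℝ u ξ (perp ξ)) ^ 2 = |fderiv ℝ u ξ (perp ξ)| ^ 2 := (sq_abs _).symm
        _ ≤ (M * ‖ξ‖) ^ 2 := pow_le_pow_left₀ (abs_nonneg _) h1 2
        _ = M ^ 2 * ‖ξ‖ ^ 2 := by ring
        _ ≤ M ^ 2 * (1 + ‖ξ‖) ^ 2 := by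
            refine mul_le_mul_of_nonneg_left ?_ (sq_nonneg _)
            exact pow_le_pow_left₀ (norm_nonneg _) (by linarith [norm_nonneg ξ]) 2
    have h3 : gaussVortexProfile ξ * ((8 * π)⁻¹ * burgersPhi (‖ξ‖ ^ 2 / 4)) * (fderiv ℝ u ξ (perp ξ)) ^ 2 ≤
        gaussVortexProfile ξ * (8 * π)⁻¹ * (M ^ 2 * (1 + ‖ξ‖) ^ 2) :=
      mul_le_mul (mul_le_mul_of_nonneg_left (hΩ1 ξ) (hG0 ξ)) h2 (sq_nonneg _) (mul_nonneg (hG0 ξ) hπ8.le)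
    rw [Real.norm_eq_abs, abs_of_nonneg (mul_nonneg (by norm_num)
      (mul_nonneg (mul_nonneg (hG0 ξ) (hΩ0 ξ)) (sq_nonneg _)))]
    calc 1 / 4 * (gaussVortexProfile ξ * ((8 * π)⁻¹ * burgersPhi (‖ξ‖ ^ 2 / 4)) * (fderiv ℝ u ξ (perp ξ)) ^ 2)
        ≤ 1 / 4 * (gaussVortexProfile ξ * (8 * π)⁻¹ * (M ^ 2 * (1 + ‖ξ‖) ^ 2)) :=
          mul_le_mul_of_nonneg_left h3 (by norm_num)
      _ = 1 / 4 * (8 * π)⁻¹ * M ^ 2 * ((1 + ‖ξ‖) ^ 2 * gaussVortexProfile ξ) := by ring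
  -- comparison circle by circle
  have key := integral_le_integral_of_forall_circle
    (F₁ := fun ξ => gaussVortexProfile ξ * ((8 * π)⁻¹ * burgersPhi (‖ξ‖ ^ 2 / 4)) * (u ξ - u₀ ξ) ^ 2)
    (F₂ := fun ξ => 1 / 4 * (gaussVortexProfile ξ * ((8 * π)⁻¹ * burgersPhi (‖ξ‖ ^ 2 / 4)) *
      (fderiv ℝ u ξ (perp ξ)) ^ 2))
    ((hGc.mul hΩc).mul ((huc.sub hu₀c).pow 2)) (continuous_const.mul ((hGc.mul hΩc).mul (hDc.pow 2)))
    (fun ξ => mul_nonneg (mul_nonneg (hG0 ξ) (hΩ0 ξ)) (sq_nonneg _))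
    (fun ξ => mul_nonneg (by norm_num) (mul_nonneg (mul_nonneg (hG0 ξ) (hΩ0 ξ)) (sq_nonneg _))) hF₂i ?_
  · rw [MeasureTheory.integral_const_mul] at key
    exact key.2
  -- the inequality on the circle of radius `r`: there `G`, `Ω` and `u₀` are constant
  intro r _
  have hG : ∀ θ : ℝ, gaussVortexProfile (toLp 2 ![r * Real.cos θ, r * Real.sin θ]) =
      (4 * π)⁻¹ * Real.exp (-(r ^ 2 / 4)) := fun θ => by
    rw [gaussVortexProfile, norm_toLp_cos_sin, sq_abs]
  have hΩ : ∀ θ : ℝ, (8 * π)⁻¹ * burgersPhi (‖(toLp 2 ![r * Real.cos θ, r * Real.sin θ] :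
      EuclideanSpace ℝ (Fin 2))‖ ^ 2 / 4) = (8 * π)⁻¹ * burgersPhi (r ^ 2 / 4) := fun θ => by
    rw [norm_toLp_cos_sin, sq_abs]
  have hu₀γ : ∀ θ : ℝ, u₀ (toLp 2 ![r * Real.cos θ, r * Real.sin θ]) =
      (2 * π)⁻¹ * ∫ t in (0:ℝ)..2 * π, u (toLp 2 ![r * Real.cos t, r * Real.sin t]) := fun θ =>
    circularMean_circlePoint hu₀ r θ
  have hmean : ∫ θ in (-π)..π, (u (toLp 2 ![r * Real.cos θ, r * Real.sin θ]) -
      (2 * π)⁻¹ * ∫ t in (0:ℝ)..2 * π, u (toLp 2 ![r * Real.cos t, r * Real.sin t])) = 0 := by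
    have h := intervalIntegral_sub_circularMean_eq_zero' hu₀ huc r
    simp only [hu₀γ] at h
    exact h
  have hcirc := intervalIntegral_sub_const_sq_circle_le u hu heven r _ hmean
  have hK : 0 ≤ (4 * π)⁻¹ * Real.exp (-(r ^ 2 / 4)) * ((8 * π)⁻¹ * burgersPhi (r ^ 2 / 4)) :=
    mul_nonneg (by positivity) (mul_nonneg hπ8.le (burgersPhi_pos _).le)
  have e1 : ∫ θ in (-π)..π, gaussVortexProfile (toLp 2 ![r * Real.cos θ, r * Real.sin θ]) *
      ((8 * π)⁻¹ * burgersPhi (‖(toLp 2 ![r * Real.cos θ, r * Real.sin θ] : EuclideanSpace ℝ (Fin 2))‖ ^ 2 / 4)) *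
      (u (toLp 2 ![r * Real.cos θ, r * Real.sin θ]) - u₀ (toLp 2 ![r * Real.cos θ, r * Real.sin θ])) ^ 2 =
      (4 * π)⁻¹ * Real.exp (-(r ^ 2 / 4)) * ((8 * π)⁻¹ * burgersPhi (r ^ 2 / 4)) *
        ∫ θ in (-π)..π, (u (toLp 2 ![r * Real.cos θ, r * Real.sin θ]) -
          (2 * π)⁻¹ * ∫ t in (0:ℝ)..2 * π, u (toLp 2 ![r * Real.cos t, r * Real.sin t])) ^ 2 := by
    simp only [hG, hΩ, hu₀γ]
    exact intervalIntegral.integral_const_mul _ _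
  have e2 : ∫ θ in (-π)..π, 1 / 4 * (gaussVortexProfile (toLp 2 ![r * Real.cos θ, r * Real.sin θ]) *
      ((8 * π)⁻¹ * burgersPhi (‖(toLp 2 ![r * Real.cos θ, r * Real.sin θ] : EuclideanSpace ℝ (Fin 2))‖ ^ 2 / 4)) *
      (fderiv ℝ u (toLp 2 ![r * Real.cos θ, r * Real.sin θ]) (perp (toLp 2 ![r * Real.cos θ, r * Real.sin θ]))) ^ 2) =
      (4 * π)⁻¹ * Real.exp (-(r ^ 2 / 4)) * ((8 * π)⁻¹ * burgersPhi (r ^ 2 / 4)) *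
        (1 / 4 * ∫ θ in (-π)..π, (fderiv ℝ u (toLp 2 ![r * Real.cos θ, r * Real.sin θ])
          (perp (toLp 2 ![r * Real.cos θ, r * Real.sin θ]))) ^ 2) := by
    simp only [hG, hΩ]
    rw [intervalIntegral.integral_const_mul, intervalIntegral.integral_const_mul]
    ring
  calc _ = _ := e1
    _ ≤ (4 * π)⁻¹ * Real.exp (-(r ^ 2 / 4)) * ((8 * π)⁻¹ * burgersPhi (r ^ 2 / 4)) *
        (1 / 4 * ∫ θ in (-π)..π, (fderiv ℝ u (toLp 2 ![r * Real.cos θ, r * Real.sin θ])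
          (perp (toLp 2 ![r * Real.cos θ, r * Real.sin θ]))) ^ 2) := mul_le_mul_of_nonneg_left hcirc hK
    _ = _ := e2.symm

end Summit.AnomalousDissipation.AnomalousDissipation.Theorems.MarginalStabilityChainStretchedVortexRows

end
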